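import Summits.BirchSwinnertonDyer.BirchSwinnertonDyer.Theorems.ResidualThetaTransportAtTwoHeckeThetaPartnerAdicAtTwoHeckeThetaClass
import Summits.BirchSwinnertonDyer.BirchSwinnertonDyer.Theorems.ResidualThetaTransportAtTwoHeckeThetaPartnerAdicAtTwoThetaLinesSpan
import HarnessLib

/-!
# The class theta series: membership in the theta span and its `q`-series (toward K0⁺, stmt-20690)

Route `ResidualThetaTransportAtTwo`, crux K0⁺ `HeckeThetaPartnerAdicAtTwo` (stmt-BirchSwinnertonDyer-20690),
line "Hecke theta series from the genus-two Riemann theta function".  THEOREMS ONLY.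

For the class theta series `F_𝔞(τ) = Σ_{x₀ ∈ 𝔞/𝔟} χ(x₀) Θ(τ; x₀ + 𝔟)` of `HeckeThetaClass`
(`𝔟 = 𝔞𝔪`, `χ(x) = ψ̃_𝔪((x))/σ(x)`):

* `classTheta_mem_span` — `F_𝔞` lies in the span of the gradient theta nulls on rational lines
  (`ThetaLinesSpan`), each `Θ(·; x₀ + 𝔟)` being `∇_u ϑ[k/M; 0](0, τ·(MB))`;
* `hasSum_classTheta` — `F_𝔞(τ) = 2πi Σ_{x ∈ 𝔞} ψ̃_𝔪((x)) q^{N(x)/N𝔞}` (the cosets of `𝔟` partition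
  `𝔞`, and `χ(x₀) σ(x) = ψ̃_𝔪((x))` on `x₀ + 𝔟`);
* `hasSum_classTheta_nat` — regrouped as a `q`-series:
  `F_𝔞(τ) = Σ_n (2πi Σ_{x ∈ 𝔞, N(x) = n N𝔞} ψ̃_𝔪((x))) qⁿ`.

BSD is not proved by this file.
-/

set_option autoImplicit false
set_option linter.dupNamespace false

noncomputable section

open scoped NumberField ComplexConjugate Real MatrixGroups UpperHalfPlane
open NumberField Module Matrix Complex Filter IsDedekindDomain

namespace Summit.BirchSwinnertonDyer.BirchSwinnertonDyer.Theorems.HeckeTheta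

open Literature.Analysis.SpecialFunctions
open Literature.NumberTheory.ModularForms.BinaryTheta
open Literature.NumberTheory.Automorphic (siegelUpperHalfSpace mem_siegelUpperHalfSpace_iff)
open Literature.NumberTheory.LFunctions (idealPow rayClassCoeff)

variable {K : Type} [Field K] [NumberField K]

/-! ### Summation over a finite family of fibres -/

/-- A family of series indexed by a finite type sums on the `Σ`-type. -/
theorem hasSum_sigma_of_fintype {β : Type} [Fintype β] {γ : β → Type} {f : (Σ b, γ b) → ℂ}
    {a : β → ℂ} (h : ∀ b, HasSum (fun c => f ⟨b, c⟩) (a b)) : HasSum f (∑ b, a b) := by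
  classical
  have h1 : ∀ b, HasSum ((Set.range (Sigma.mk b)).indicator f) (a b) := by
    intro b
    rw [← hasSum_subtype_iff_indicator]
    show HasSum (fun x : Set.range (Sigma.mk b) => f x.1) (a b)
    rw [(sigma_mk_injective).hasSum_range_iff]
    exact h b
  have h2 := hasSum_sum (s := Finset.univ) fun b _ => h1 b
  refine h2.congr_fun fun p => ?_
  obtain ⟨b₀, c⟩ := p
  rw [Finset.sum_eq_single b₀]
  · rw [Set.indicator_of_mem (Set.mem_range.mpr ⟨c, rfl⟩)]
  · intro b _ hb
    rw [Set.indicator_of_notMem]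
    rintro ⟨c', hc'⟩
    exact hb (congrArg Sigma.fst hc')
  · intro h; exact absurd (Finset.mem_univ _) h

/-! ### The class theta series lies in the theta span -/

/-- **`F_𝔞 ∈ V`**, the span of the gradient theta nulls on rational lines. -/
theorem classTheta_mem_span (σ : K →+* ℂ) {𝔪 : Ideal (𝓞 K)} (h𝔪 : 𝔪 ≠ ⊥)
    (ψ : HeightOneSpectrum (𝓞 K) → ℂ)
    {𝔞 𝔟 : Ideal (𝓞 K)} (h𝔟 : 𝔟 = 𝔞 * 𝔪) (b : Basis (Fin 2) ℤ 𝔟)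
    {B : Matrix (Fin 2) (Fin 2) ℤ} (hsymm : B.IsSymm) (hpos : (B.map (Int.cast : ℤ → ℝ)).PosDef)
    (Θ : 𝓞 K → ℍ → ℂ)
    (hΘ : ∀ x₀ ∈ 𝔞, ∀ k : Fin 2 → ℤ, ((b.equivFun.symm k : 𝔟) : 𝓞 K) = (Ideal.absNorm 𝔪 : 𝓞 K) * x₀ →
      ∀ τ : ℍ, Θ x₀ τ = fderiv ℂ (riemannThetaChar (fun i => (k i : ℂ) / (Ideal.absNorm 𝔪 : ℕ)) 0
        ((((Ideal.absNorm 𝔪 : ℕ) : ℂ) * (τ : ℂ)) • B.map ((↑) : ℤ → ℂ))) 0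
        (fun i => σ ((b i : 𝓞 K) : K)))
    (hΘ0 : ∀ x₀, x₀ ∉ 𝔞 → ∀ τ : ℍ, Θ x₀ τ = 0)
    (ρ : 𝓞 K ⧸ 𝔟 → 𝓞 K) [Fintype (𝓞 K ⧸ 𝔟)] (F : ℍ → ℂ)
    (hF : ∀ τ, F τ = ∑ q : 𝓞 K ⧸ 𝔟,
      rayClassCoeff 𝔪 ψ (Ideal.span {ρ q}) / σ (ρ q : K) * Θ (ρ q) τ) :
    F ∈ Submodule.span ℂ {F : ℍ → ℂ | ∃ (P : Matrix (Fin 2) (Fin 2) ℚ), P.IsSymm ∧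
        (P.map (Rat.cast : ℚ → ℝ)).PosDef ∧ ∃ (a b : Fin 2 → ℚ) (u : Fin 2 → ℂ), F = fun τ : ℍ =>
          fderiv ℂ (riemannThetaChar (fun i => (a i : ℂ)) (fun i => (b i : ℂ))
            ((τ : ℂ) • P.map (Rat.cast : ℚ → ℂ))) 0 u} := by
  set M : ℕ := Ideal.absNorm 𝔪 with hMdef
  have hM : M ≠ 0 := by rw [hMdef, Ne, Ideal.absNorm_eq_zero_iff]; exact h𝔪
  -- the rational line matrix `M B`
  set P : Matrix (Fin 2) (Fin 2) ℚ := (M : ℚ) • B.map (Int.cast : ℤ → ℚ) with hP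
  have hPs : P.IsSymm := (hsymm.map _).smul _
  have hPpos : (P.map (Rat.cast : ℚ → ℝ)).PosDef := by
    have : P.map (Rat.cast : ℚ → ℝ) = (M : ℝ) • B.map (Int.cast : ℤ → ℝ) := by
      ext i j; simp [hP]
    rw [this]
    exact hpos.smul (by exact_mod_cast Nat.pos_of_ne_zero hM)
  have hPc : ∀ τ : ℂ, (((M : ℕ) : ℂ) * τ) • B.map ((↑) : ℤ → ℂ) = τ • P.map (Rat.cast : ℚ → ℂ) := by
    intro τ; ext i j; simp [hP]; ring
  have hFeq : F = ∑ q : 𝓞 K ⧸ 𝔟,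
      (rayClassCoeff 𝔪 ψ (Ideal.span {ρ q}) / σ (ρ q : K)) • fun τ => Θ (ρ q) τ := by
    funext τ; rw [hF τ]; simp [Finset.sum_apply]
  rw [hFeq]
  refine Submodule.sum_mem _ fun q _ => Submodule.smul_mem _ _ ?_
  by_cases hq : ρ q ∈ 𝔞
  · obtain ⟨k, hk⟩ := exists_coords h𝔟 b hq
    have hfun : (fun τ : ℍ => Θ (ρ q) τ) = fun τ : ℍ => fderiv ℂ (riemannThetaChar
        (fun i => (((k i : ℚ) / M : ℚ) : ℂ)) (fun i => ((0 : ℚ) : ℂ))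
        ((τ : ℂ) • P.map (Rat.cast : ℚ → ℂ))) 0 (fun i => σ ((b i : 𝓞 K) : K)) := by
      funext τ
      rw [hΘ _ hq k hk τ, hPc]
      congr 3
      · funext i; push_cast; rfl
      · funext i; simp
    rw [hfun]
    exact Submodule.subset_span ⟨P, hPs, hPpos, fun i => (k i : ℚ) / M, fun _ => 0, _, rfl⟩
  · have hfun : (fun τ : ℍ => Θ (ρ q) τ) = 0 := by funext τ; exact hΘ0 _ hq τ
    rw [hfun]; exact Submodule.zero_mem _


/-! ### The `q`-series of the class theta series -/

/-- On a coset `x₀ + 𝔟 ⊆ 𝔞` (`𝔪 ≠ 1`): `χ(x₀) σ(x) = ψ̃_𝔪((x))`. -/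
theorem chi_mul_embedding_eq (σ : K →+* ℂ) {𝔪 : Ideal (𝓞 K)} (h𝔪1 : 𝔪 ≠ ⊤)
    {ψ : HeightOneSpectrum (𝓞 K) → ℂ}
    (hψ : ∀ b c : 𝓞 K, b ≠ 0 → c ≠ 0 → IsCoprime (Ideal.span {c}) 𝔪 → b - c ∈ 𝔪 →
      idealPow K ψ (Ideal.span {b}) = idealPow K ψ (Ideal.span {c}) * σ ((b : K) / c))
    {𝔟 : Ideal (𝓞 K)} (h𝔟𝔪 : 𝔟 ≤ 𝔪) {x₀ x : 𝓞 K} (hx : x - x₀ ∈ 𝔟) :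
    rayClassCoeff 𝔪 ψ (Ideal.span {x₀}) / σ (x₀ : K) * σ (x : K) = rayClassCoeff 𝔪 ψ (Ideal.span {x}) := by
  classical
  by_cases hx0 : x = 0
  · rw [hx0]; simp [Literature.NumberTheory.LFunctions.rayClassCoeff_bot]
  by_cases hx₀0 : x₀ = 0
  · -- `x ∈ 𝔟 ⊆ 𝔪`, so `(x)` is not prime to `𝔪`
    rw [hx₀0]
    simp only [Ideal.span_singleton_zero, Literature.NumberTheory.LFunctions.rayClassCoeff_bot, map_zero,
      div_zero, zero_mul]
    have hxm : x ∈ 𝔪 := h𝔟𝔪 (by simpa [hx₀0] using hx)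
    have hnc : ¬ IsCoprime (Ideal.span {x}) 𝔪 := by
      intro hc
      rw [Ideal.isCoprime_iff_sup_eq, sup_eq_right.mpr ((Ideal.span_singleton_le_iff_mem _).mpr hxm)] at hc
      exact h𝔪1 hc
    rw [rayClassCoeff, if_neg (not_and.mpr fun _ => hnc)]
  · have hσx : σ (x : K) ≠ 0 := by rw [map_ne_zero]; exact_mod_cast hx0
    rw [← chi_periodic σ hψ hx0 hx₀0 (h𝔟𝔪 hx), div_mul_cancel₀ _ hσx]

/-- **`F_𝔞(τ) = 2πi Σ_{x ∈ 𝔞} ψ̃_𝔪((x)) q^{N((x))/N𝔞}`** as an absolutely convergent sum over `𝔞`. -/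
theorem hasSum_classTheta (hK : finrank ℚ K = 2) [IsTotallyComplex K] (σ : K →+* ℂ)
    {𝔪 : Ideal (𝓞 K)} (h𝔪 : 𝔪 ≠ ⊥) (h𝔪1 : 𝔪 ≠ ⊤) {ψ : HeightOneSpectrum (𝓞 K) → ℂ}
    (hψ : ∀ b c : 𝓞 K, b ≠ 0 → c ≠ 0 → IsCoprime (Ideal.span {c}) 𝔪 → b - c ∈ 𝔪 →
      idealPow K ψ (Ideal.span {b}) = idealPow K ψ (Ideal.span {c}) * σ ((b : K) / c))
    {𝔞 𝔟 : Ideal (𝓞 K)} (h𝔟 : 𝔟 = 𝔞 * 𝔪) (h𝔞 : 𝔞 ≠ ⊥) (b : Basis (Fin 2) ℤ 𝔟)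
    {B : Matrix (Fin 2) (Fin 2) ℤ}
    (hB : ∀ i j, ((B i j : ℤ) : ℂ) * ((Ideal.absNorm 𝔟 : ℕ) : ℂ) =
      σ ((b i : 𝓞 K) : K) * conj (σ ((b j : 𝓞 K) : K)) + conj (σ ((b i : 𝓞 K) : K)) * σ ((b j : 𝓞 K) : K))
    (hsymm : B.IsSymm) (hpos : (B.map (Int.cast : ℤ → ℝ)).PosDef)
    (Θ : 𝓞 K → ℍ → ℂ)
    (hΘ : ∀ x₀ ∈ 𝔞, ∀ k : Fin 2 → ℤ, ((b.equivFun.symm k : 𝔟) : 𝓞 K) = (Ideal.absNorm 𝔪 : 𝓞 K) * x₀ →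
      ∀ τ : ℍ, Θ x₀ τ = fderiv ℂ (riemannThetaChar (fun i => (k i : ℂ) / (Ideal.absNorm 𝔪 : ℕ)) 0
        ((((Ideal.absNorm 𝔪 : ℕ) : ℂ) * (τ : ℂ)) • B.map ((↑) : ℤ → ℂ))) 0
        (fun i => σ ((b i : 𝓞 K) : K)))
    (hΘ0 : ∀ x₀, x₀ ∉ 𝔞 → ∀ τ : ℍ, Θ x₀ τ = 0)
    (ρ : 𝓞 K ⧸ 𝔟 → 𝓞 K) (hρ : ∀ q, Ideal.Quotient.mk 𝔟 (ρ q) = q) [Fintype (𝓞 K ⧸ 𝔟)]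
    (F : ℍ → ℂ)
    (hF : ∀ τ, F τ = ∑ q : 𝓞 K ⧸ 𝔟,
      rayClassCoeff 𝔪 ψ (Ideal.span {ρ q}) / σ (ρ q : K) * Θ (ρ q) τ) (τ : ℍ) :
    HasSum (fun x : 𝔞 => 2 * π * I * rayClassCoeff 𝔪 ψ (Ideal.span {(x : 𝓞 K)}) *
        cexp (2 * π * I * (τ : ℂ)) ^ (Ideal.absNorm (Ideal.span {(x : 𝓞 K)}) / Ideal.absNorm 𝔞)) (F τ) := by
  classical
  set M : ℕ := Ideal.absNorm 𝔪 with hMdef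
  have hM : M ≠ 0 := by rw [hMdef, Ne, Ideal.absNorm_eq_zero_iff]; exact h𝔪
  have h𝔟𝔞 : 𝔟 ≤ 𝔞 := by rw [h𝔟]; exact Ideal.mul_le_right
  have h𝔟𝔪 : 𝔟 ≤ 𝔪 := by rw [h𝔟]; exact Ideal.mul_le_left
  obtain ⟨π₀, hπ₀⟩ : ∃ π₀ : 𝔞 → 𝓞 K ⧸ 𝔟, π₀ = fun x : 𝔞 => Ideal.Quotient.mk 𝔟 (x : 𝓞 K) := ⟨_, rfl⟩
  obtain ⟨G, hG⟩ : ∃ G : 𝔞 → ℂ, G = fun x : 𝔞 => 2 * π * I * rayClassCoeff 𝔪 ψ (Ideal.span {(x : 𝓞 K)}) *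
    cexp (2 * π * I * (τ : ℂ)) ^ (Ideal.absNorm (Ideal.span {(x : 𝓞 K)}) / Ideal.absNorm 𝔞) := ⟨_, rfl⟩
  -- the fibre sums
  have hfib : ∀ q : 𝓞 K ⧸ 𝔟, HasSum (fun x : {x : 𝔞 // π₀ x = q} => G x.1)
      (rayClassCoeff 𝔪 ψ (Ideal.span {ρ q}) / σ (ρ q : K) * Θ (ρ q) τ) := by
    intro q
    by_cases hq : ρ q ∈ 𝔞
    · obtain ⟨k, hk⟩ := exists_coords h𝔟 b hq
      have hS := (hasSum_fderiv_thetaCoset hK σ h𝔟 h𝔞 h𝔪 b hB hsymm hpos hq hk τ.im_pos).mul_left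
        (rayClassCoeff 𝔪 ψ (Ideal.span {ρ q}) / σ (ρ q : K))
      rw [← hΘ _ hq k hk τ] at hS
      -- the bijection `m ↦ ρ q + x_m` onto the fibre
      have hmem : ∀ m : Fin 2 → ℤ, ρ q + ((b.equivFun.symm m : 𝔟) : 𝓞 K) ∈ 𝔞 :=
        fun m => 𝔞.add_mem hq (h𝔟𝔞 (b.equivFun.symm m).2)
      have hcls : ∀ m : Fin 2 → ℤ, π₀ ⟨_, hmem m⟩ = q := by
        intro m
        have h1 : Ideal.Quotient.mk 𝔟 (ρ q + ((b.equivFun.symm m : 𝔟) : 𝓞 K)) =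
            Ideal.Quotient.mk 𝔟 (ρ q) := by
          rw [Ideal.Quotient.mk_eq_mk_iff_sub_mem, add_sub_cancel_left]
          exact (b.equivFun.symm m).2
        simp only [hπ₀]
        rw [h1, hρ]
      have hsub : ∀ x : {x : 𝔞 // π₀ x = q}, ((x.1 : 𝓞 K) - ρ q) ∈ 𝔟 := by
        intro x
        have hx2 := x.2
        rw [show π₀ x.1 = Ideal.Quotient.mk 𝔟 (x.1 : 𝓞 K) from congrFun hπ₀ x.1] at hx2
        rw [← Ideal.Quotient.mk_eq_mk_iff_sub_mem, hρ]
        exact hx2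
      set e : (Fin 2 → ℤ) → {x : 𝔞 // π₀ x = q} := fun m => ⟨⟨_, hmem m⟩, hcls m⟩ with he
      have he_bij : Function.Bijective e := by
        constructor
        · intro m m' h
          have h' : ρ q + ((b.equivFun.symm m : 𝔟) : 𝓞 K) = ρ q + ((b.equivFun.symm m' : 𝔟) : 𝓞 K) :=
            congrArg (fun z : {x : 𝔞 // π₀ x = q} => ((z.1 : 𝔞) : 𝓞 K)) h
          exact b.equivFun.symm.injective (Subtype.ext (add_left_cancel h'))
        · intro x
          refine ⟨b.equivFun ⟨(x.1 : 𝓞 K) - ρ q, hsub x⟩, ?_⟩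
          apply Subtype.ext; apply Subtype.ext
          simp only [he, LinearEquiv.symm_apply_apply]
          ring
      have hS' : HasSum ((fun x : {x : 𝔞 // π₀ x = q} => G x.1) ∘ (Equiv.ofBijective e he_bij))
          (rayClassCoeff 𝔪 ψ (Ideal.span {ρ q}) / σ (ρ q : K) * Θ (ρ q) τ) := by
        refine hS.congr_fun fun m => ?_
        simp only [Function.comp_apply, Equiv.ofBijective_apply, he, hG, Submodule.coe_mk]
        rw [← chi_mul_embedding_eq σ h𝔪1 hψ h𝔟𝔪 (x₀ := ρ q)
          (x := ρ q + ((b.equivFun.symm m : 𝔟) : 𝓞 K)) (by rw [add_sub_cancel_left]; exact (b.equivFun.symm m).2)]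
        push_cast
        ring
      exact (Equiv.hasSum_iff (Equiv.ofBijective e he_bij)).mp hS'
    · -- empty fibre
      haveI : IsEmpty {x : 𝔞 // π₀ x = q} := by
        refine ⟨fun x => hq ?_⟩
        have h1 : ((x.1 : 𝓞 K) - ρ q) ∈ 𝔟 := by
          have hx2 := x.2
          rw [show π₀ x.1 = Ideal.Quotient.mk 𝔟 (x.1 : 𝓞 K) from congrFun hπ₀ x.1] at hx2
          rw [← Ideal.Quotient.mk_eq_mk_iff_sub_mem, hρ]; exact hx2
        have : ρ q = (x.1 : 𝓞 K) - ((x.1 : 𝓞 K) - ρ q) := by ring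
        rw [this]
        exact 𝔞.sub_mem x.1.2 (h𝔟𝔞 h1)
      rw [hΘ0 _ hq τ, mul_zero]
      letI : Fintype {x : 𝔞 // π₀ x = q} := Fintype.ofIsEmpty
      have h := hasSum_fintype (fun x : {x : 𝔞 // π₀ x = q} => G x.1)
      rwa [Fintype.sum_empty] at h
  have h := hasSum_sigma_of_fintype
    (f := fun p : (Σ q : 𝓞 K ⧸ 𝔟, {x : 𝔞 // π₀ x = q}) => G p.2.1) hfib
  rw [← hF τ] at h
  have h' : HasSum G (F τ) := (Equiv.hasSum_iff (Equiv.sigmaFiberEquiv π₀)).mp h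
  rw [hG] at h'
  exact h'

/-- **The `q`-series of `F_𝔞`**: `F_𝔞(τ) = Σ_n (2πi Σ_{x ∈ 𝔞, N((x)) = n N𝔞} ψ̃_𝔪((x))) qⁿ`. -/
theorem hasSum_classTheta_nat (hK : finrank ℚ K = 2) [IsTotallyComplex K] (σ : K →+* ℂ)
    {𝔪 : Ideal (𝓞 K)} (h𝔪 : 𝔪 ≠ ⊥) (h𝔪1 : 𝔪 ≠ ⊤) {ψ : HeightOneSpectrum (𝓞 K) → ℂ}
    (hψ : ∀ b c : 𝓞 K, b ≠ 0 → c ≠ 0 → IsCoprime (Ideal.span {c}) 𝔪 → b - c ∈ 𝔪 →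
      idealPow K ψ (Ideal.span {b}) = idealPow K ψ (Ideal.span {c}) * σ ((b : K) / c))
    {𝔞 𝔟 : Ideal (𝓞 K)} (h𝔟 : 𝔟 = 𝔞 * 𝔪) (h𝔞 : 𝔞 ≠ ⊥) (b : Basis (Fin 2) ℤ 𝔟)
    {B : Matrix (Fin 2) (Fin 2) ℤ}
    (hB : ∀ i j, ((B i j : ℤ) : ℂ) * ((Ideal.absNorm 𝔟 : ℕ) : ℂ) =
      σ ((b i : 𝓞 K) : K) * conj (σ ((b j : 𝓞 K) : K)) + conj (σ ((b i : 𝓞 K) : K)) * σ ((b j : 𝓞 K) : K))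
    (hsymm : B.IsSymm) (hpos : (B.map (Int.cast : ℤ → ℝ)).PosDef)
    (Θ : 𝓞 K → ℍ → ℂ)
    (hΘ : ∀ x₀ ∈ 𝔞, ∀ k : Fin 2 → ℤ, ((b.equivFun.symm k : 𝔟) : 𝓞 K) = (Ideal.absNorm 𝔪 : 𝓞 K) * x₀ →
      ∀ τ : ℍ, Θ x₀ τ = fderiv ℂ (riemannThetaChar (fun i => (k i : ℂ) / (Ideal.absNorm 𝔪 : ℕ)) 0
        ((((Ideal.absNorm 𝔪 : ℕ) : ℂ) * (τ : ℂ)) • B.map ((↑) : ℤ → ℂ))) 0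
        (fun i => σ ((b i : 𝓞 K) : K)))
    (hΘ0 : ∀ x₀, x₀ ∉ 𝔞 → ∀ τ : ℍ, Θ x₀ τ = 0)
    (ρ : 𝓞 K ⧸ 𝔟 → 𝓞 K) (hρ : ∀ q, Ideal.Quotient.mk 𝔟 (ρ q) = q) [Fintype (𝓞 K ⧸ 𝔟)]
    (F : ℍ → ℂ)
    (hF : ∀ τ, F τ = ∑ q : 𝓞 K ⧸ 𝔟,
      rayClassCoeff 𝔪 ψ (Ideal.span {ρ q}) / σ (ρ q : K) * Θ (ρ q) τ) (τ : ℍ) :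
    HasSum (fun n : ℕ => (2 * π * I * ∑ᶠ x : {x : 𝓞 K // x ∈ 𝔞 ∧
        Ideal.absNorm (Ideal.span {x}) = n * Ideal.absNorm 𝔞}, rayClassCoeff 𝔪 ψ (Ideal.span {x.1})) *
        cexp (2 * π * I * (τ : ℂ)) ^ n) (F τ) := by
  classical
  have hsum := hasSum_classTheta hK σ h𝔪 h𝔪1 hψ h𝔟 h𝔞 b hB hsymm hpos Θ hΘ hΘ0 ρ hρ F hF τ
  have hN0 : Ideal.absNorm 𝔞 ≠ 0 := by rw [Ne, Ideal.absNorm_eq_zero_iff]; exact h𝔞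
  set kf : 𝔞 → ℕ := fun x => Ideal.absNorm (Ideal.span {(x : 𝓞 K)}) / Ideal.absNorm 𝔞 with hkf
  have hkf_iff : ∀ (x : 𝔞) (n : ℕ), kf x = n ↔
      Ideal.absNorm (Ideal.span {(x : 𝓞 K)}) = n * Ideal.absNorm 𝔞 := by
    intro x n
    obtain ⟨c, hc⟩ := Ideal.absNorm_dvd_absNorm_of_le ((Ideal.span_singleton_le_iff_mem _).mpr x.2)
    rw [hkf]; simp only
    rw [hc, Nat.mul_div_cancel_left _ (Nat.pos_of_ne_zero hN0), mul_comm]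
    exact ⟨fun h => by rw [h], fun h => mul_right_cancel₀ hN0 h⟩
  -- fibres of `kf` ≃ `{x ∈ 𝔞 : N((x)) = n N𝔞}`
  set g : ∀ n, {x : 𝔞 // kf x = n} →
      {x : 𝓞 K // x ∈ 𝔞 ∧ Ideal.absNorm (Ideal.span {x}) = n * Ideal.absNorm 𝔞} :=
    fun n x => ⟨(x.1 : 𝓞 K), x.1.2, (hkf_iff x.1 n).mp x.2⟩ with hg
  have hg_bij : ∀ n, Function.Bijective (g n) := by
    intro n
    constructor
    · intro x x' h
      apply Subtype.ext; apply Subtype.ext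
      exact congrArg (fun z => (z.1 : 𝓞 K)) h
    · rintro ⟨x, hx, hxn⟩
      exact ⟨⟨⟨x, hx⟩, (hkf_iff ⟨x, hx⟩ n).mpr hxn⟩, rfl⟩
  haveI hfin : ∀ n, Finite {x : 𝔞 // kf x = n} := fun n =>
    haveI := finite_norm_eq hK 𝔞 n
    Finite.of_injective (g n) (hg_bij n).1
  have h1 := (Equiv.hasSum_iff (Equiv.sigmaFiberEquiv kf)).mpr hsum
  refine h1.sigma fun n => ?_
  letI : Fintype {x : 𝔞 // kf x = n} := Fintype.ofFinite _
  haveI : Finite {x : 𝓞 K // x ∈ 𝔞 ∧ Ideal.absNorm (Ideal.span {x}) = n * Ideal.absNorm 𝔞} :=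
    finite_norm_eq hK 𝔞 n
  letI : Fintype {x : 𝓞 K // x ∈ 𝔞 ∧ Ideal.absNorm (Ideal.span {x}) = n * Ideal.absNorm 𝔞} :=
    Fintype.ofFinite _
  have h2 := hasSum_fintype (fun c : {x : 𝔞 // kf x = n} =>
    ((fun x : 𝔞 => 2 * π * I * rayClassCoeff 𝔪 ψ (Ideal.span {(x : 𝓞 K)}) *
        cexp (2 * π * I * (τ : ℂ)) ^ (Ideal.absNorm (Ideal.span {(x : 𝓞 K)}) / Ideal.absNorm 𝔞)) ∘
      (Equiv.sigmaFiberEquiv kf)) ⟨n, c⟩)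
  have hterm : ∀ c : {x : 𝔞 // kf x = n},
      ((fun x : 𝔞 => 2 * π * I * rayClassCoeff 𝔪 ψ (Ideal.span {(x : 𝓞 K)}) *
        cexp (2 * π * I * (τ : ℂ)) ^ (Ideal.absNorm (Ideal.span {(x : 𝓞 K)}) / Ideal.absNorm 𝔞)) ∘
        (Equiv.sigmaFiberEquiv kf)) ⟨n, c⟩ =
        2 * π * I * rayClassCoeff 𝔪 ψ (Ideal.span {((g n c).1 : 𝓞 K)}) * cexp (2 * π * I * (τ : ℂ)) ^ n := by
    intro c
    simp only [Function.comp_apply, Equiv.sigmaFiberEquiv_apply, hg]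
    have : Ideal.absNorm (Ideal.span {((c.1 : 𝔞) : 𝓞 K)}) / Ideal.absNorm 𝔞 = n := c.2
    rw [this]
  have hval : ∑ c : {x : 𝔞 // kf x = n},
      ((fun x : 𝔞 => 2 * π * I * rayClassCoeff 𝔪 ψ (Ideal.span {(x : 𝓞 K)}) *
        cexp (2 * π * I * (τ : ℂ)) ^ (Ideal.absNorm (Ideal.span {(x : 𝓞 K)}) / Ideal.absNorm 𝔞)) ∘
        (Equiv.sigmaFiberEquiv kf)) ⟨n, c⟩ =
      (2 * π * I * ∑ᶠ x : {x : 𝓞 K // x ∈ 𝔞 ∧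
        Ideal.absNorm (Ideal.span {x}) = n * Ideal.absNorm 𝔞}, rayClassCoeff 𝔪 ψ (Ideal.span {x.1})) *
        cexp (2 * π * I * (τ : ℂ)) ^ n := by
    simp only [hterm]
    rw [← Finset.sum_mul, ← Finset.mul_sum, finsum_eq_sum_of_fintype,
      Fintype.sum_bijective (g n) (hg_bij n) (fun c => rayClassCoeff 𝔪 ψ (Ideal.span {((g n c).1 : 𝓞 K)}))
        (fun x => rayClassCoeff 𝔪 ψ (Ideal.span {x.1})) (fun c => rfl)]
  rw [hval] at h2
  exact h2

end Summit.BirchSwinnertonDyer.BirchSwinnertonDyer.Theorems.HeckeTheta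

end
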